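import Literature.AnabelianGeometry.AbsoluteAnabelian.HolomorphicEllipticCuspidalization
import Literature.AlgebraicTopology.FundamentalGroup.PuncturedTorusSquareWord
import Literature.Topology.CoveringSpaces.ExteriorDiscCovering
import HarnessLib

/-!
# [AbsTopIII] Cor 2.7 (b).7, part 1: the chart at the puncture of the torus, read at infinity

S. Mochizuki, *Topics in absolute anabelian geometry III*, Cor. 2.7 (b), kurims p. 59: "`𝕌 → 𝔼` is
an abelian finite étale covering [which necessarily extends to a covering of the one-point
compactification of `E^top`]".  Towards the cell sub-node (b).7
`HolomorphicEllipticCuspidalization.AbelianCoverOfPuncturedTorusExtends`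
(plan/L4/SUBDAG-AbsTopIII-Cor-27.md row r10; proof completed in
`HolomorphicEllipticCuspidalizationPunctureProofs.lean`), this file sets up the local coordinate at
the puncture `0 ∈ T = ComplexTorus Φ` in the form used by the tree's
`Literature/Topology/CoveringSpaces/ExteriorDiscCovering.lean` (Forster, Thm. 5.10, read at
infinity):

* `chart0 Φ` — the tree's `ComplexTorus.chart` centred at `0` (`zero_mem_source`, `chart0_zero`,
  `chart0_symm_apply`: its inverse is `z ↦ projC 0 (2 · Φ⁻¹ z)` in the coordinates of
  `PuncturedTorusSquareWord`, `norm_two_smul_symm_lt`);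
* `rad Φ`, `goodNhd Φ` — a disc `|z| < r` inside the chart and the neighbourhood `W` of `0` over it;
* `toExt Φ : T → ℂ`, `t ↦ 1/𝒞(t)` on `W` (else `0`) and its inverse `ofExt Φ`: `W ∖ {0}` is carried
  bijectively and bicontinuously onto the exterior `{1/r < |w|}` (`toExt_mem_iff`, `ofExt_spec`,
  `toExt_ofExt`, `ofExt_toExt`, `toExt_injOn`, `continuousOn_toExt`, `continuousOn_ofExt`,
  `goodNhdEHomeomorph`);
* **`isCoveringMapOn_ext`** — for a finite étale `q : Y → 𝔼 = T ∖ {0}`, the coordinate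
  `p = toExt ∘ q : Y → ℂ` is a covering map ON the exterior, with finite fibres (`finite_fibre_ext`).

The `def`s are coordinates (chart, radius, neighbourhood, `w`, `w⁻¹`, the homeomorphism); no named
facts; everything else is proved.  HONEST FRAMING: infrastructure for OUR proof of a step of a
refereed paper; nothing here bears on [IUTchIII] Cor. 3.12.

## References

* S. Mochizuki, *Topics in absolute anabelian geometry III*, Cor. 2.7 (b) p. 59. [MochizukiAbsTopIII2015]
* O. Forster, *Lectures on Riemann Surfaces*, GTM 81, Thm. 5.10. [Forster1981]
-/

noncomputable section

open Set Function Metric Topology unitInterval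
open Literature.Geometry.Kaehler (ComplexTorus)
open Literature.Topology.CoveringSpaces
open Literature.AlgebraicTopology.FundamentalGroup

namespace Literature.AnabelianGeometry.AbsoluteAnabelian

namespace HolomorphicEllipticCuspidalization

namespace PunctureProofs

variable {ι : Type} [Fintype ι] (Φ : (ι → ℝ) ≃L[ℝ] ℂ)

/-! ### §1 The chart at the puncture and the coordinate `w = 1/𝒞` -/

/-- `|ι| = 2`: `Φ` is a real-linear isomorphism `ℝ^ι ≅ ℂ`. [cite: MochizukiAbsTopIII2015, Corollary 2.7 (b) p.59] -/
theorem card_eq_two (Φ : (ι → ℝ) ≃L[ℝ] ℂ) : Fintype.card ι = 2 := by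
  have h := LinearEquiv.finrank_eq Φ.toLinearEquiv
  rw [Module.finrank_fintype_fun_eq_card, Complex.finrank_real_complex] at h
  exact h

/-- The chart of `T = ComplexTorus Φ` at `0`: the box of half-width `1/2` centred at the origin,
read in `ℂ` through `Φ`. [cite: MochizukiAbsTopIII2015, Corollary 2.7 (b) p.59] -/
def chart0 : OpenPartialHomeomorph (ComplexTorus Φ) ℂ := ComplexTorus.chart Φ (fun _ ↦ -2⁻¹)

/-- `0` lies in the chart domain. [cite: MochizukiAbsTopIII2015, Corollary 2.7 (b) p.59] -/
theorem zero_mem_source : (0 : ComplexTorus Φ) ∈ (chart0 Φ).source := by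
  rw [chart0, ComplexTorus.chart_source]
  intro i h
  have h' : (((-2⁻¹ : ℝ)) : AddCircle (1 : ℝ)) = 0 := h.symm
  obtain ⟨n, hn⟩ := (AddCircle.coe_eq_zero_iff (1 : ℝ)).1 h'
  rw [zsmul_eq_mul, mul_one] at hn
  have h2 : ((2 * n : ℤ) : ℝ) = -1 := by push_cast; rw [hn]; norm_num
  have h3 : (2 * n : ℤ) = -1 := by exact_mod_cast h2
  omega

/-- The chart sends `0` to `0`. [cite: MochizukiAbsTopIII2015, Corollary 2.7 (b) p.59] -/
theorem chart0_zero : chart0 Φ 0 = 0 := by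
  rw [chart0, ComplexTorus.chart_apply]
  have : (fun i ↦ ((AddCircle.equivIco (1 : ℝ) ((fun _ : ι ↦ (-2⁻¹ : ℝ)) i)
      ((0 : ComplexTorus Φ) i) : ℝ))) = 0 := by
    funext i
    have h0 : (0 : ComplexTorus Φ) i = ((0 : ℝ) : AddCircle (1 : ℝ)) := by
      rw [AddCircle.coe_zero]; rfl
    rw [h0, AddCircle.equivIco_coe_eq (by constructor <;> norm_num)]
    rfl
  rw [this, map_zero]

/-- Points of the chart target have small box coordinates: `‖2 · Φ⁻¹ z‖ < 1`.
[cite: MochizukiAbsTopIII2015, Corollary 2.7 (b) p.59] -/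
theorem norm_two_smul_symm_lt {z : ℂ} (hz : z ∈ (chart0 Φ).target) : ‖(2 : ℝ) • Φ.symm z‖ < 1 := by
  rw [chart0, ComplexTorus.chart_target] at hz
  rw [norm_smul, Real.norm_eq_abs, abs_of_pos (by norm_num : (0 : ℝ) < 2)]
  have h : ‖Φ.symm z‖ < 2⁻¹ := by
    refine (pi_norm_lt_iff (by norm_num)).2 fun i ↦ ?_
    have hi := hz i (mem_univ i)
    rw [Real.norm_eq_abs, abs_lt]
    constructor <;> linarith [hi.1, hi.2]
  linarith

/-- The inverse chart is `z ↦ Φ⁻¹ z (mod ℤ^ι)`, i.e. `projC 0 (2 · Φ⁻¹ z)` in the coordinates of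
`PuncturedTorusCommutator`. [cite: MochizukiAbsTopIII2015, Corollary 2.7 (b) p.59] -/
theorem chart0_symm_apply (z : ℂ) :
    ((chart0 Φ).symm z : ι → AddCircle (1 : ℝ)) = PuncturedTorus.projC (0 : ι → ℝ) ((2 : ℝ) • Φ.symm z) := by
  rw [chart0, ComplexTorus.chart_symm_apply]
  funext i
  simp only [ComplexTorus.proj_apply, PuncturedTorus.projC_apply, Pi.smul_apply, smul_eq_mul,
    Pi.zero_apply, zero_add]
  congr 1
  ring

/-- A round disc inside the chart target. [cite: MochizukiAbsTopIII2015, Corollary 2.7 (b) p.59] -/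
theorem exists_ball_subset_target : ∃ r : ℝ, 0 < r ∧ ball (0 : ℂ) r ⊆ (chart0 Φ).target := by
  have h0 : (0 : ℂ) ∈ (chart0 Φ).target := by
    rw [← chart0_zero Φ]
    exact (chart0 Φ).map_source (zero_mem_source Φ)
  obtain ⟨r, hr, hsub⟩ := Metric.isOpen_iff.1 (chart0 Φ).open_target 0 h0
  exact ⟨r, hr, hsub⟩

/-- The radius `r` of a disc inside the chart target. [cite: MochizukiAbsTopIII2015, Corollary 2.7 (b) p.59] -/
def rad : ℝ := (exists_ball_subset_target Φ).choose

/-- `r > 0`. [cite: MochizukiAbsTopIII2015, Corollary 2.7 (b) p.59] -/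
theorem rad_pos : 0 < rad Φ := (exists_ball_subset_target Φ).choose_spec.1

/-- The disc of radius `r` lies in the chart target. [cite: MochizukiAbsTopIII2015, Corollary 2.7 (b) p.59] -/
theorem ball_rad_subset : ball (0 : ℂ) (rad Φ) ⊆ (chart0 Φ).target :=
  (exists_ball_subset_target Φ).choose_spec.2

/-- The neighbourhood `W = 𝒞⁻¹(|z| < r)` of the puncture. [cite: MochizukiAbsTopIII2015, Corollary 2.7 (b) p.59] -/
def goodNhd : Set (ComplexTorus Φ) := {t | t ∈ (chart0 Φ).source ∧ ‖chart0 Φ t‖ < rad Φ}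

/-- `W` is open. [cite: MochizukiAbsTopIII2015, Corollary 2.7 (b) p.59] -/
theorem isOpen_goodNhd : IsOpen (goodNhd Φ) := by
  have h := (chart0 Φ).continuousOn.isOpen_inter_preimage (chart0 Φ).open_source
    (Metric.isOpen_ball (x := (0 : ℂ)) (ε := rad Φ))
  convert h using 1
  ext t
  simp [goodNhd]

/-- `0 ∈ W`. [cite: MochizukiAbsTopIII2015, Corollary 2.7 (b) p.59] -/
theorem zero_mem_goodNhd : (0 : ComplexTorus Φ) ∈ goodNhd Φ :=
  ⟨zero_mem_source Φ, by rw [chart0_zero, norm_zero]; exact rad_pos Φ⟩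

/-- In `W`, only the puncture has chart coordinate `0`. [cite: MochizukiAbsTopIII2015, Corollary 2.7 (b) p.59] -/
theorem chart0_ne_zero {t : ComplexTorus Φ} (ht : t ∈ (chart0 Φ).source) (h0 : t ≠ 0) :
    chart0 Φ t ≠ 0 := fun h ↦
  h0 ((chart0 Φ).injOn ht (zero_mem_source Φ) (h.trans (chart0_zero Φ).symm))

open Classical in
/-- **The coordinate `w = 1/𝒞(t)`** on `W` (and `0` elsewhere): it carries `W ∖ {0}` onto the exterior
`{1/r < |w|}` of a disc. [cite: Forster1981, Thm. 5.10 (the punctured disc read at infinity)] -/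
def toExt (t : ComplexTorus Φ) : ℂ := if t ∈ goodNhd Φ then (chart0 Φ t)⁻¹ else 0

/-- The inverse coordinate `w ↦ 𝒞⁻¹(1/w)`. [cite: Forster1981, Thm. 5.10] -/
def ofExt (w : ℂ) : ComplexTorus Φ := (chart0 Φ).symm w⁻¹

/-- `toExt` on `W`. [cite: Forster1981, Thm. 5.10] -/
theorem toExt_of_mem {t : ComplexTorus Φ} (ht : t ∈ goodNhd Φ) : toExt Φ t = (chart0 Φ t)⁻¹ := by
  rw [toExt, if_pos ht]

/-- **`w(t)` lies in the exterior iff `t ∈ W ∖ {0}`.** [cite: Forster1981, Thm. 5.10] -/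
theorem toExt_mem_iff (t : ComplexTorus Φ) :
    toExt Φ t ∈ extDisc (rad Φ)⁻¹ ↔ t ∈ goodNhd Φ ∧ t ≠ 0 := by
  constructor
  · intro h
    by_cases ht : t ∈ goodNhd Φ
    · refine ⟨ht, fun h0 ↦ ?_⟩
      rw [toExt_of_mem Φ ht, h0, chart0_zero, inv_zero] at h
      exact (ne_zero_of_mem_extDisc (inv_pos.2 (rad_pos Φ)) h) rfl
    · rw [toExt, if_neg ht] at h
      exact ((ne_zero_of_mem_extDisc (inv_pos.2 (rad_pos Φ)) h) rfl).elim
  · rintro ⟨ht, h0⟩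
    rw [toExt_of_mem Φ ht, extDisc, mem_setOf_eq, norm_inv]
    have hne := chart0_ne_zero Φ ht.1 h0
    exact (inv_lt_inv₀ (rad_pos Φ) (norm_pos_iff.2 hne)).2 ht.2

/-- `ofExt` maps the exterior into `W ∖ {0}`, and `𝒞 (ofExt w) = 1/w`. [cite: Forster1981, Thm. 5.10] -/
theorem ofExt_spec {w : ℂ} (hw : w ∈ extDisc (rad Φ)⁻¹) :
    ofExt Φ w ∈ goodNhd Φ ∧ ofExt Φ w ≠ 0 ∧ chart0 Φ (ofExt Φ w) = w⁻¹ := by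
  have hw0 : w ≠ 0 := ne_zero_of_mem_extDisc (inv_pos.2 (rad_pos Φ)) hw
  have hwi : ‖w⁻¹‖ < rad Φ := by
    rw [norm_inv]
    have := (inv_lt_inv₀ (norm_pos_iff.2 hw0) (inv_pos.2 (rad_pos Φ))).2 hw
    rwa [inv_inv] at this
  have htgt : w⁻¹ ∈ (chart0 Φ).target := ball_rad_subset Φ (by rwa [mem_ball, dist_zero_right])
  have hsrc : ofExt Φ w ∈ (chart0 Φ).source := (chart0 Φ).map_target htgt
  have hval : chart0 Φ (ofExt Φ w) = w⁻¹ := (chart0 Φ).right_inv htgt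
  have hgood : ofExt Φ w ∈ goodNhd Φ := ⟨hsrc, by rwa [hval]⟩
  refine ⟨hgood, fun h0 ↦ ?_, hval⟩
  have := chart0_zero Φ
  rw [← h0, hval] at this
  exact inv_ne_zero hw0 this

/-- `toExt ∘ ofExt = id` on the exterior. [cite: Forster1981, Thm. 5.10] -/
theorem toExt_ofExt {w : ℂ} (hw : w ∈ extDisc (rad Φ)⁻¹) : toExt Φ (ofExt Φ w) = w := by
  obtain ⟨hgood, -, hval⟩ := ofExt_spec Φ hw
  rw [toExt_of_mem Φ hgood, hval, inv_inv]

/-- `ofExt ∘ toExt = id` on `W ∖ {0}`. [cite: Forster1981, Thm. 5.10] -/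
theorem ofExt_toExt {t : ComplexTorus Φ} (ht : t ∈ goodNhd Φ) :
    ofExt Φ (toExt Φ t) = t := by
  rw [toExt_of_mem Φ ht, ofExt, inv_inv]
  exact (chart0 Φ).left_inv ht.1

/-- `toExt` is injective on `W ∖ {0}` (indeed on `W`-points with value in the exterior).
[cite: Forster1981, Thm. 5.10] -/
theorem toExt_injOn {t t' : ComplexTorus Φ} (ht : toExt Φ t ∈ extDisc (rad Φ)⁻¹)
    (h : toExt Φ t = toExt Φ t') : t = t' := by
  have ht' : toExt Φ t' ∈ extDisc (rad Φ)⁻¹ := h ▸ ht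
  obtain ⟨h1, -⟩ := (toExt_mem_iff Φ t).1 ht
  obtain ⟨h1', -⟩ := (toExt_mem_iff Φ t').1 ht'
  rw [← ofExt_toExt Φ h1, ← ofExt_toExt Φ h1', h]

/-- `toExt` is continuous on `W ∖ {0}`. [cite: Forster1981, Thm. 5.10] -/
theorem continuousOn_toExt : ContinuousOn (toExt Φ) (goodNhd Φ \ {0}) := by
  have h1 : ContinuousOn (fun t ↦ (chart0 Φ t)⁻¹) (goodNhd Φ \ {0}) := by
    refine ContinuousOn.inv₀ ((chart0 Φ).continuousOn.mono fun t ht ↦ ht.1.1) fun t ht ↦ ?_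
    exact chart0_ne_zero Φ ht.1.1 ht.2
  exact h1.congr fun t ht ↦ toExt_of_mem Φ ht.1

/-- `ofExt` is continuous on the exterior. [cite: Forster1981, Thm. 5.10] -/
theorem continuousOn_ofExt : ContinuousOn (ofExt Φ) (extDisc (rad Φ)⁻¹) := by
  refine (chart0 Φ).continuousOn_symm.comp (continuousOn_inv₀.mono fun w hw ↦ ?_) fun w hw ↦ ?_
  · exact ne_zero_of_mem_extDisc (inv_pos.2 (rad_pos Φ)) hw
  · have hw0 : w ≠ 0 := ne_zero_of_mem_extDisc (inv_pos.2 (rad_pos Φ)) hw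
    have hwi : ‖w⁻¹‖ < rad Φ := by
      rw [norm_inv]
      have := (inv_lt_inv₀ (norm_pos_iff.2 hw0) (inv_pos.2 (rad_pos Φ))).2 hw
      rwa [inv_inv] at this
    exact ball_rad_subset Φ (by rwa [mem_ball, dist_zero_right])

/-! ### §1' The coordinate `w ∘ q` of a covering of the punctured torus is a covering on the exterior -/

section Covering

variable {Φ} {Y : Type} [TopologicalSpace Y] (q : Y → puncturedTorus Φ) (hq : IsFiniteEtale q)

/-- The punctured good neighbourhood, as a subset of `𝔼 = T ∖ {0}`. [cite: Forster1981, Thm. 5.10] -/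
def goodNhdE : Set ↥(puncturedTorus Φ) := {e | (e : ComplexTorus Φ) ∈ goodNhd Φ}

/-- `W ∖ {0} ⊂ 𝔼` is open. [cite: Forster1981, Thm. 5.10] -/
theorem isOpen_goodNhdE : IsOpen (goodNhdE (Φ := Φ)) :=
  (isOpen_goodNhd Φ).preimage continuous_subtype_val

/-- The homeomorphism `W ∖ {0} ≃ {1/r < |w|}` given by `w = 1/𝒞`. [cite: Forster1981, Thm. 5.10] -/
def goodNhdEHomeomorph : ↥(goodNhdE (Φ := Φ)) ≃ₜ ↥(extDisc (rad Φ)⁻¹) where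
  toFun e := ⟨toExt Φ (e : ↥(puncturedTorus Φ)),
    (toExt_mem_iff Φ _).2 ⟨e.2, (e : ↥(puncturedTorus Φ)).2⟩⟩
  invFun w := ⟨⟨ofExt Φ w, (ofExt_spec Φ w.2).2.1⟩, (ofExt_spec Φ w.2).1⟩
  left_inv e := Subtype.ext (Subtype.ext (ofExt_toExt Φ e.2))
  right_inv w := Subtype.ext (toExt_ofExt Φ w.2)
  continuous_toFun := by
    apply Continuous.subtype_mk
    exact (continuousOn_toExt Φ).comp_continuous
      (continuous_subtype_val.comp continuous_subtype_val) fun e ↦ ⟨e.2, (e : ↥(puncturedTorus Φ)).2⟩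
  continuous_invFun := by
    apply Continuous.subtype_mk
    apply Continuous.subtype_mk
    exact (continuousOn_ofExt Φ).comp_continuous continuous_subtype_val fun w ↦ w.2

include hq in
/-- **`p := w ∘ q : Y → ℂ` is a covering map on the exterior `{1/r < |w|}`** (the restriction of
`q` over `W ∖ {0}`, read through the homeomorphism `w`). [cite: Forster1981, Thm. 5.10] -/
theorem isCoveringMapOn_ext :
    IsCoveringMapOn (fun y ↦ toExt Φ (q y : ComplexTorus Φ)) (extDisc (rad Φ)⁻¹) := by
  set p : Y → ℂ := fun y ↦ toExt Φ (q y : ComplexTorus Φ) with hp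
  have hpre : p ⁻¹' extDisc (rad Φ)⁻¹ = q ⁻¹' goodNhdE := by
    ext y
    simp only [mem_preimage, hp, toExt_mem_iff, goodNhdE, mem_setOf_eq]
    exact ⟨fun h ↦ h.1, fun h ↦ ⟨h, (q y).2⟩⟩
  have h1 : IsCoveringMap ((goodNhdE (Φ := Φ)).restrictPreimage q) :=
    hq.isCoveringMap.restrictPreimage _
  have h2 : IsCoveringMap ((goodNhdEHomeomorph (Φ := Φ)) ∘ (goodNhdE (Φ := Φ)).restrictPreimage q) :=
    h1.homeomorph_comp _
  let ψ : ↥(p ⁻¹' extDisc (rad Φ)⁻¹) ≃ₜ ↥(q ⁻¹' goodNhdE) := Homeomorph.setCongr hpre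
  have h3 : IsCoveringMap
      (((goodNhdEHomeomorph (Φ := Φ)) ∘ (goodNhdE (Φ := Φ)).restrictPreimage q) ∘ ψ) :=
    h2.comp_homeomorph ψ
  have heq : ((goodNhdEHomeomorph (Φ := Φ)) ∘ (goodNhdE (Φ := Φ)).restrictPreimage q) ∘ ψ =
      (extDisc (rad Φ)⁻¹).restrictPreimage p := by
    funext y
    rfl
  rw [heq] at h3
  refine IsCoveringMapOn.of_isCoveringMap_restrictPreimage _ (isOpen_extDisc _) ?_ h3
  rw [hpre]
  exact isOpen_goodNhdE.preimage hq.isCoveringMap.continuous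

include hq in
/-- The fibres of `p = w ∘ q` over the exterior are finite (they are fibres of `q`).
[cite: Forster1981, Thm. 5.10] -/
theorem finite_fibre_ext (y : Y) (hy : toExt Φ (q y : ComplexTorus Φ) ∈ extDisc (rad Φ)⁻¹) :
    ((fun y' ↦ toExt Φ (q y' : ComplexTorus Φ)) ⁻¹' {toExt Φ (q y : ComplexTorus Φ)}).Finite := by
  refine (hq.finite_fibre (q y)).subset fun y' hy' ↦ ?_
  have h : toExt Φ (q y' : ComplexTorus Φ) = toExt Φ (q y : ComplexTorus Φ) := hy'
  have : (q y' : ComplexTorus Φ) = q y := toExt_injOn Φ (h ▸ hy) h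
  exact Subtype.ext this

end Covering

end PunctureProofs

end HolomorphicEllipticCuspidalization

end Literature.AnabelianGeometry.AbsoluteAnabelian

end
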